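import Literature.NumberTheory.Weil1964.AdelicMetaplecticKernel
import HarnessLib

/-!
# Two homomorphisms into `Mp_ψ(𝕎_𝔸)ᶜᵒⁿᵗ` over the same symplectic map differ by a continuous character

[GelbartRogawski1991, §3.1 Remark p. 457 L9–13]: "*If `s*` is any other compatible splitting, then `s* = s ⊗ ν′`,
where `ν′` is an automorphic character of `E¹`, regarded as a character of `G` with values in the central subgroup `ℂ*`
of `Mp_𝐀(W)`*".  The tree's `GelbartRogawski1991.SplittingDatum.IsCompatible.exists_central_twist` proves the abstract
"only if" half over any datum with central `ker π` (a theorem for `Mp_ψ(𝕎_𝔸)ᶜᵒⁿᵗ`: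
`adelicMpCont.mem_center_of_proj_eq_one` of `AdelicMetaplecticKernel`), producing `ν : G(𝔸) →* ker π`.  This file
reads `ker π = ℂˣ` (`AdelicMetaplecticKernel`) to produce the SCALAR character, for ARBITRARY homomorphisms over the
same symplectic map — no rationality, no compatibility needed: e.g. a compatible splitting restricted to the
finite-adelic points versus a finite-adelic section assembled from local splittings (`FinLocalSplittings.finSplitting`).
Everything is stated in the currency `s ⊗ η := adelicMpCont.twist F ι T s η` of `AdelicMetaplecticScalarTwist`.

* §1 generic bookkeeping: if `(t₁ h)⁻¹ · t₂ h = z(c_h)` for an injective homomorphism `z` onto central elements, then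
  `h ↦ c_h` IS a homomorphism (`exists_monoidHom_of_inv_mul_eq`);
* §2 **`adelicMpCont.exists_eq_twist`**: for `s₁ s₂ : H →* Mp_ψ(𝕎_𝔸)ᶜᵒⁿᵗ` with `π ∘ s₁ = π ∘ s₂` (`T` invertible) there
  is `χ : H →* ℂˣ` with `s₂ = s₁ ⊗ χ`; it is unique (`twist_right_injective`), satisfies
  `ω(s₂ h) Φ = χ(h) • ω(s₁ h) Φ` (`omega_eq_smul_of_eq_twist`), and is **continuous** for the topology of record when
  `s₁`, `s₂` are (`continuous_of_eq_twist`: near any point `χ` is the ratio of two continuous matrix coefficients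
  `h ↦ (ω(s_i h) Φ₀)(x)`, `adelicMpCont.continuous_omega_apply`, with non-vanishing denominator) —
  packaged: `exists_eq_twist_continuous`;
* §3 on the finite Weil representations of `AdelicMetaplecticFinRep` (symplectic components fixing the archimedean
  vectors): **`finRepMp s₂ h = χ(h) • finRepMp s₁ h`** (`finRepMp_eq_smul_of_eq_twist`, by `finRepMp_unique`).

KERNEL MATHEMATICS ONLY: theorems; no definition, no named fact, no `sorry`.

## References
* [GelbartRogawski1991] S. Gelbart, J. Rogawski, *L-functions and Fourier–Jacobi coefficients for the unitary group
  U(3)*, Invent. Math. 105 (1991), §3.1 p. 454 L21–33 (`ω_ψ(g, M_g) = M_g`; the exact sequence), Prop. 3.1.1 p. 455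
  L1–3 ("continuous section"), Remark p. 457 L9–13 (`s* = s ⊗ ν′`).
* [Weil1964] A. Weil, *Sur certains groupes d'opérateurs unitaires*, Acta Math. 111 (1964) 143–211, Chap. III
  n° 37–39 pp. 188–190 (the adelic metaplectic group, its topology, continuity of `(S, Φ) ↦ SΦ`).
* [MoeglinVignerasWaldspurger1987] C. Mœglin, M.-F. Vignéras, J.-L. Waldspurger, *Correspondances de Howe sur un
  corps p-adique*, LNM 1291 (1987), Chap. 2 II.1 (B).
-/

set_option autoImplicit false

noncomputable section

open scoped Matrix TensorProduct Topology
open NumberField NumberField.mixedEmbedding IsDedekindDomain Filter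

namespace Literature.NumberTheory.Weil1964

open Literature.NumberTheory.Automorphic Literature.RepresentationTheory.HeisenbergGroup

variable {F : Type} [Field F] [NumberField F] {ι : Type} [Fintype ι] [DecidableEq ι]
  {T : Matrix ι ι (AdeleRing (𝓞 F) F)}

/-! ## §1 Generic bookkeeping: two homomorphisms differing by central elements -/

section Generic

variable {H G C : Type*} [Group H] [Group G] [CommGroup C] (t₁ t₂ : H →* G) (z : C →* G)

/-- if `(t₁ h)⁻¹ · t₂ h = z(c_h)` with `z` an injective homomorphism onto central elements, then `h ↦ c_h` is a
homomorphism `χ` with `(t₁ h)⁻¹ · t₂ h = z(χ h)` (the group-theory behind "`s* = s ⊗ ν′`").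
[cite: GelbartRogawski1991, §3.1 Remark p. 457 L9–13] -/
theorem exists_monoidHom_of_inv_mul_eq (hz : Function.Injective z) (hzc : ∀ c, z c ∈ Subgroup.center G)
    (hex : ∀ h, ∃ c, (t₁ h)⁻¹ * t₂ h = z c) : ∃ χ : H →* C, ∀ h, (t₁ h)⁻¹ * t₂ h = z (χ h) := by
  choose c hc using hex
  have hcomm : ∀ (h : H) (m : G), m * ((t₁ h)⁻¹ * t₂ h) = (t₁ h)⁻¹ * t₂ h * m := fun h m => by
    rw [hc h]
    exact Subgroup.mem_center_iff.1 (hzc _) m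
  refine ⟨MonoidHom.mk' c fun h h' => hz ?_, fun h => hc h⟩
  rw [map_mul z, ← hc (h * h'), ← hc h, ← hc h', map_mul t₁, map_mul t₂, mul_inv_rev]
  calc (t₁ h')⁻¹ * (t₁ h)⁻¹ * (t₂ h * t₂ h')
      = (t₁ h')⁻¹ * ((t₁ h)⁻¹ * t₂ h) * t₂ h' := by group
    _ = (t₁ h)⁻¹ * t₂ h * (t₁ h')⁻¹ * t₂ h' := by rw [hcomm h (t₁ h')⁻¹]
    _ = (t₁ h)⁻¹ * t₂ h * ((t₁ h')⁻¹ * t₂ h') := by group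

/-- `(t₁ h)⁻¹ · t₂ h = m` central `⟹ t₂ h = m · t₁ h`. [cite: GelbartRogawski1991, §3.1 Remark p. 457 L9–13] -/
theorem eq_mul_of_inv_mul_eq_of_mem_center {h : H} {m : G} (hm : m ∈ Subgroup.center G)
    (hc : (t₁ h)⁻¹ * t₂ h = m) : t₂ h = m * t₁ h := by
  rw [← Subgroup.mem_center_iff.1 hm (t₁ h), ← hc, mul_inv_cancel_left]

/-- if `π ∘ t₁ = π ∘ t₂` then `(t₁ h)⁻¹ · t₂ h` lies over `1`. [cite: GelbartRogawski1991, §3.1 Remark p. 457 L9–13] -/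
theorem map_inv_mul_eq_one_of_forall_eq {Sp : Type*} [Group Sp] (π : G →* Sp)
    (hπ : ∀ h, π (t₁ h) = π (t₂ h)) (h : H) : π ((t₁ h)⁻¹ * t₂ h) = 1 := by
  rw [map_mul, map_inv, hπ h, inv_mul_cancel]

end Generic

/-! ## §2 Two homomorphisms into `Mp_ψ(𝕎_𝔸)ᶜᵒⁿᵗ` over the same symplectic map -/

section TwoSections

variable {H : Type*} [Group H] (s₁ s₂ : H →* adelicMpCont F ι T)

/-- **`s₂ = s₁ ⊗ χ` for some character `χ : H →* ℂˣ`**, whenever `π ∘ s₁ = π ∘ s₂` (`T` invertible): the quotients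
`(s₁ h)⁻¹ · s₂ h` lie over `1`, hence are central scalars (`AdelicMetaplecticKernel`), and the scalars multiply.
[cite: GelbartRogawski1991, §3.1 Remark p. 457 L9–13] -/
theorem adelicMpCont.exists_eq_twist (hT : IsUnit T)
    (hproj : ∀ h : H, adelicMpCont.proj F ι T (s₁ h) = adelicMpCont.proj F ι T (s₂ h)) :
    ∃ χ : H →* ℂˣ, s₂ = adelicMpCont.twist F ι T s₁ χ := by
  have hex : ∀ h, ∃ c : ℂˣ, (s₁ h)⁻¹ * s₂ h = adelicMpCont.ofScalar F ι T c := fun h =>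
    adelicMpCont.exists_eq_ofScalar_of_proj_eq_one hT _
      (map_inv_mul_eq_one_of_forall_eq s₁ s₂ (adelicMpCont.proj F ι T) hproj h)
  refine (exists_monoidHom_of_inv_mul_eq s₁ s₂ (adelicMpCont.ofScalar F ι T) adelicMpCont.ofScalar_injective
    adelicMpCont.ofScalar_mem_center hex).elim fun χ hχ => ⟨χ, MonoidHom.ext fun h => ?_⟩
  exact eq_mul_of_inv_mul_eq_of_mem_center s₁ s₂ (adelicMpCont.ofScalar_mem_center _) (hχ h)

variable {s₁ s₂} {χ : H →* ℂˣ}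

/-- the symplectic components of `s₁ ⊗ χ` and `s₁` agree (converse bookkeeping). [cite: GelbartRogawski1991, §3.1 Remark p. 457 L9–13] -/
theorem adelicMpCont.proj_eq_of_eq_twist (hχ : s₂ = adelicMpCont.twist F ι T s₁ χ) (h : H) :
    adelicMpCont.proj F ι T (s₁ h) = adelicMpCont.proj F ι T (s₂ h) := by
  rw [hχ]
  exact (adelicMpCont.proj_twist (s := s₁) (η := χ) h).symm

/-- **on the Weil representation: `ω(s₂ h) Φ = χ(h) • ω(s₁ h) Φ`** for `s₂ = s₁ ⊗ χ`. [cite: GelbartRogawski1991, §3.1 p. 454 L21–33] -/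
theorem adelicMpCont.omega_eq_smul_of_eq_twist (hχ : s₂ = adelicMpCont.twist F ι T s₁ χ) (h : H)
    (Φ : piSchwartzBruhat F ι) :
    adelicMpCont.omega F ι T (s₂ h) Φ = ((χ h : ℂˣ) : ℂ) • adelicMpCont.omega F ι T (s₁ h) Φ := by
  subst hχ
  exact adelicMpCont.omega_twist (s := s₁) (η := χ) h Φ

/-- the same on VALUES of functions: `(ω(s₂ h) Φ)(x) = χ(h) · (ω(s₁ h) Φ)(x)`. [cite: GelbartRogawski1991, §3.1 p. 454 L21–33] -/
theorem adelicMpCont.coe_omega_apply_eq_mul_of_eq_twist (hχ : s₂ = adelicMpCont.twist F ι T s₁ χ) (h : H)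
    (Φ : piSchwartzBruhat F ι) (x : ι → AdeleRing (𝓞 F) F) :
    ((adelicMpCont.omega F ι T (s₂ h) Φ : piSchwartzBruhat F ι) : (ι → AdeleRing (𝓞 F) F) → ℂ) x =
      ((χ h : ℂˣ) : ℂ) * ((adelicMpCont.omega F ι T (s₁ h) Φ : piSchwartzBruhat F ι) : (ι → AdeleRing (𝓞 F) F) → ℂ) x :=
  (congr_arg (fun Ψ : piSchwartzBruhat F ι => ((Ψ : piSchwartzBruhat F ι) : (ι → AdeleRing (𝓞 F) F) → ℂ) x)
    (adelicMpCont.omega_eq_smul_of_eq_twist hχ h Φ)).trans (piSchwartzBruhat_coe_smul_apply _ _ x)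

/-- **uniqueness of the character**: a character `η` with `ω(s₂ h) Φ = η(h) • ω(s₁ h) Φ` for all `h, Φ` is `χ`
(`𝒮(𝔸_F^ι) ≠ 0` and the `ω(s₁ h)` are injective). [cite: GelbartRogawski1991, §3.1 Remark p. 457 L9–13] -/
theorem adelicMpCont.eq_of_forall_omega_eq_smul (hχ : s₂ = adelicMpCont.twist F ι T s₁ χ) (η : H →* ℂˣ)
    (hη : ∀ (h : H) (Φ : piSchwartzBruhat F ι),
      adelicMpCont.omega F ι T (s₂ h) Φ = ((η h : ℂˣ) : ℂ) • adelicMpCont.omega F ι T (s₁ h) Φ) :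
    η = χ := by
  refine MonoidHom.ext fun h => ?_
  obtain ⟨Φ₀, hΦ₀⟩ := exists_piSchwartzBruhat_ne_zero (K := F) ι
  exact Units.ext (smul_left_injective ℂ (adelicMpCont.omega_apply_ne_zero (s₁ h) hΦ₀)
    ((hη h Φ₀).symm.trans (adelicMpCont.omega_eq_smul_of_eq_twist hχ h Φ₀)))

/-- **`s ↦ s ⊗ χ` is injective in `χ`**: `s₁ ⊗ χ = s₁ ⊗ χ' → χ = χ'`. [cite: GelbartRogawski1991, §3.1 Remark p. 457 L9–13] -/
theorem adelicMpCont.twist_right_injective (s : H →* adelicMpCont F ι T) :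
    Function.Injective (adelicMpCont.twist F ι T s) := fun χ χ' hχχ' =>
  adelicMpCont.eq_of_forall_omega_eq_smul (s₁ := s) (s₂ := adelicMpCont.twist F ι T s χ') (χ := χ') rfl χ
    fun h Φ => ((congrArg (fun t : H →* adelicMpCont F ι T => adelicMpCont.omega F ι T (t h) Φ) hχχ').symm.trans
      (adelicMpCont.omega_twist (s := s) (η := χ) h Φ))

/-- **uniqueness**: the character with `s₂ = s₁ ⊗ χ` is unique. [cite: GelbartRogawski1991, §3.1 Remark p. 457 L9–13] -/
theorem adelicMpCont.existsUnique_eq_twist (hT : IsUnit T)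
    (hproj : ∀ h : H, adelicMpCont.proj F ι T (s₁ h) = adelicMpCont.proj F ι T (s₂ h)) :
    ∃! χ : H →* ℂˣ, s₂ = adelicMpCont.twist F ι T s₁ χ := by
  refine (adelicMpCont.exists_eq_twist s₁ s₂ hT hproj).elim fun χ hχ => ⟨χ, hχ, fun χ' hχ' => ?_⟩
  exact adelicMpCont.twist_right_injective s₁ (hχ'.symm.trans hχ)

/-- calculus: a function that is, near `x₀`, the ratio of two continuous functions with non-vanishing denominator is
continuous at `x₀`. [folklore] -/
private theorem continuousAt_of_mul_eq {X : Type*} [TopologicalSpace X] {c Nu D : X → ℂ} {x₀ : X}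
    (hNc : Continuous Nu) (hDc : Continuous D) (hD0 : D x₀ ≠ 0) (hND : ∀ x, Nu x = c x * D x) :
    ContinuousAt c x₀ := by
  have hopen : ∀ᶠ x in 𝓝 x₀, D x ≠ 0 := (isOpen_compl_singleton.preimage hDc).mem_nhds hD0
  have heq : c =ᶠ[𝓝 x₀] fun x => Nu x / D x := by
    filter_upwards [hopen] with x hx
    rw [hND x, mul_div_cancel_right₀ _ hx]
  exact ContinuousAt.congr ((hNc.continuousAt).div (hDc.continuousAt) hD0) heq.symm

/-- **Continuity of the character** for the topology of record on `Mp_ψ(𝕎_𝔸)ᶜᵒⁿᵗ` (initial topology of the `π`-orbit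
maps and the matrix coefficients `p ↦ (ω(p) Φ)(x)`): if `s₂ = s₁ ⊗ χ` with `s₁`, `s₂` continuous then `χ` is continuous —
near any `h₀` it is the ratio of two continuous matrix coefficients, the denominator non-vanishing.
[cite: GelbartRogawski1991, §3.1 Prop. 3.1.1 p. 455 L1–3; Weil1964, Chap. III n° 39 p. 189] -/
theorem adelicMpCont.continuous_of_eq_twist [TopologicalSpace H] (hχ : s₂ = adelicMpCont.twist F ι T s₁ χ)
    (hc₁ : Continuous s₁) (hc₂ : Continuous s₂) : Continuous fun h : H => ((χ h : ℂˣ) : ℂ) := by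
  refine continuous_iff_continuousAt.2 fun h₀ => ?_
  -- a test function and a point where `ω(s₁ h₀) Φ₀` does not vanish
  obtain ⟨Φ₀, hΦ₀⟩ := exists_piSchwartzBruhat_ne_zero (K := F) ι
  have hv : adelicMpCont.omega F ι T (s₁ h₀) Φ₀ ≠ 0 := adelicMpCont.omega_apply_ne_zero (s₁ h₀) hΦ₀
  have hne : ((adelicMpCont.omega F ι T (s₁ h₀) Φ₀ : piSchwartzBruhat F ι) : (ι → AdeleRing (𝓞 F) F) → ℂ) ≠ 0 :=
    fun h0 => hv (Subtype.ext h0)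
  obtain ⟨x, hx⟩ := Function.ne_iff.mp hne
  exact continuousAt_of_mul_eq ((adelicMpCont.continuous_omega_apply Φ₀ x).comp hc₂)
    ((adelicMpCont.continuous_omega_apply Φ₀ x).comp hc₁) hx
    (fun h => adelicMpCont.coe_omega_apply_eq_mul_of_eq_twist hχ h Φ₀ x)

/-- continuity as a map into `ℂˣ`. [cite: GelbartRogawski1991, §3.1 Prop. 3.1.1 p. 455 L1–3] -/
theorem adelicMpCont.continuous_units_of_eq_twist [TopologicalSpace H] (hχ : s₂ = adelicMpCont.twist F ι T s₁ χ)
    (hc₁ : Continuous s₁) (hc₂ : Continuous s₂) : Continuous χ := by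
  refine Units.continuous_iff.2 ⟨adelicMpCont.continuous_of_eq_twist hχ hc₁ hc₂, ?_⟩
  simp only [Units.val_inv_eq_inv_val]
  exact (adelicMpCont.continuous_of_eq_twist hχ hc₁ hc₂).inv₀ fun h => Units.ne_zero _

variable (s₁ s₂) in
/-- **packaged**: along continuous `s₁`, `s₂` over the same symplectic map there is a CONTINUOUS character `χ` with
`s₂ = s₁ ⊗ χ`. [cite: GelbartRogawski1991, §3.1 Prop. 3.1.1 p. 455 L1–3, Remark p. 457 L9–13] -/
theorem adelicMpCont.exists_eq_twist_continuous [TopologicalSpace H] (hT : IsUnit T)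
    (hproj : ∀ h : H, adelicMpCont.proj F ι T (s₁ h) = adelicMpCont.proj F ι T (s₂ h))
    (hc₁ : Continuous s₁) (hc₂ : Continuous s₂) :
    ∃ χ : H →* ℂˣ, Continuous χ ∧ s₂ = adelicMpCont.twist F ι T s₁ χ :=
  (adelicMpCont.exists_eq_twist s₁ s₂ hT hproj).elim fun χ hχ =>
    ⟨χ, adelicMpCont.continuous_units_of_eq_twist hχ hc₁ hc₂, hχ⟩

end TwoSections

/-! ## §3 On the finite Weil representations -/

section FinRep

variable {H : Type*} [Group H] (hT : IsUnit T) {s₁ s₂ : H →* adelicMpCont F ι T} {χ : H →* ℂˣ}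
  (hχ : s₂ = adelicMpCont.twist F ι T s₁ χ)
  (harch₁ : ∀ (h : H) (a w : ι → mixedSpace F),
    (adelicMpCont.proj F ι T (s₁ h)).1 (archVec F ι a, archVec F ι w) = (archVec F ι a, archVec F ι w))
  (harch₂ : ∀ (h : H) (a w : ι → mixedSpace F),
    (adelicMpCont.proj F ι T (s₂ h)).1 (archVec F ι a, archVec F ι w) = (archVec F ι a, archVec F ι w))

/-- the archimedean-vector hypothesis transfers along `π ∘ s₁ = π ∘ s₂`. [cite: Weil1964, Chap. III n° 37–38 pp. 188–190] -/
theorem adelicMpCont.harch_of_proj_eq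
    (hproj : ∀ h : H, adelicMpCont.proj F ι T (s₁ h) = adelicMpCont.proj F ι T (s₂ h))
    (harch₁ : ∀ (h : H) (a w : ι → mixedSpace F),
      (adelicMpCont.proj F ι T (s₁ h)).1 (archVec F ι a, archVec F ι w) = (archVec F ι a, archVec F ι w))
    (h : H) (a w : ι → mixedSpace F) :
    (adelicMpCont.proj F ι T (s₂ h)).1 (archVec F ι a, archVec F ι w) = (archVec F ι a, archVec F ι w) := by
  rw [← hproj h]
  exact harch₁ h a w

include hχ in
/-- **`ω_f^{s₂}(h) = χ(h) • ω_f^{s₁}(h)`**: the finite Weil representations of `s₂ = s₁ ⊗ χ` and `s₁` (symplectic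
components fixing the archimedean vectors) differ by `χ` (uniqueness of the finite factor, `finRepMp_unique`).
[cite: Weil1964, Chap. III n° 37–38 pp. 188–190; GelbartRogawski1991, §3.1 Remark p. 457 L9–13] -/
theorem finRepMp_eq_smul_of_eq_twist (h : H) (f : FinSB F ι) :
    finRepMp hT s₂ harch₂ h f = ((χ h : ℂˣ) : ℂ) • finRepMp hT s₁ harch₁ h f := by
  have hΦ₀ : unitSchwartz F ι ≠ 0 := by
    intro h0
    have h1 := unitSchwartz_apply_zero (F := F) (ι := ι)
    rw [h0] at h1
    simp at h1
  have hB : ∀ g : FinSB F ι,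
      adelicMpCont.omega F ι T (s₂ h) (piSchwartzBruhatEquiv F ι (unitSchwartz F ι ⊗ₜ[ℂ] g)) =
        piSchwartzBruhatEquiv F ι (unitSchwartz F ι ⊗ₜ[ℂ] ((((χ h : ℂˣ) : ℂ) • finRepMp hT s₁ harch₁ h) g)) :=
    fun g => by
    rw [adelicMpCont.omega_eq_smul_of_eq_twist hχ, omega_map_tmul_finRepMp hT s₁ harch₁ h, LinearMap.smul_apply,
      TensorProduct.tmul_smul, LinearEquiv.map_smul]
  rw [← finRepMp_unique hT s₂ harch₂ h hΦ₀ hB, LinearMap.smul_apply]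

include hχ in
/-- the same as an identity of operators. [cite: GelbartRogawski1991, §3.1 Remark p. 457 L9–13] -/
theorem finRepMp_eq_smul_of_eq_twist' (h : H) :
    finRepMp hT s₂ harch₂ h = ((χ h : ℂˣ) : ℂ) • finRepMp hT s₁ harch₁ h :=
  LinearMap.ext fun f => (finRepMp_eq_smul_of_eq_twist hT hχ harch₁ harch₂ h f).trans (by rw [LinearMap.smul_apply])

end FinRep

end Literature.NumberTheory.Weil1964

end
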